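import Mathlib.Algebra.MvPolynomial.PDeriv
import Mathlib.Algebra.MvPolynomial.Monad
import Mathlib.RingTheory.Polynomial.Basic
import Mathlib.LinearAlgebra.Matrix.Rank
import Mathlib.LinearAlgebra.Matrix.MvPolynomial
import Mathlib.LinearAlgebra.Matrix.ToLinearEquiv
import Mathlib.Tactic.LinearCombination
import Literature.Computability.AlgebraicComplexity.DeterminantalComplexityProofs
import HarnessLib

/-!
# The Hessian of a polynomial and the Mignon–Ressayre rank bound

Trunk: algebraic complexity, notion `determinantal_complexity`.

For a polynomial `f : MvPolynomial σ k` and a point `x : σ → k` the *Hessian matrix*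
`hessianMatrix f x : Matrix σ σ k` has entries `(∂ᵤ ∂ᵥ f)(x)`. This file proves the part of the
Mignon–Ressayre argument (Mignon–Ressayre 2004, §§2–3; Cai–Chen–Li 2010, §2.1; exposition in
Landsberg 2017, §6.4, and Alper–Bogart–Velasco / Boralevi et al., arXiv:2202.13016, §3) that is
independent of the permanent:

* `pderiv_aeval_eq_sum`: the first-order chain rule
  `∂ᵥ (g ∘ φ) = ∑ₜ ((∂ₜ g) ∘ φ) · ∂ᵥ φₜ` for a polynomial substitution `φ`;
* `hessianMatrix_aeval_of_affine`: for an *affine* substitution (`∂ᵤ ∂ᵥ φₜ = 0`),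
  `Hess (g ∘ φ)(x) = Lᵀ · Hess g (φ(x)) · L` with `L t v = (∂ᵥ φₜ)(x)`;
* `rank_hessianMatrix_detPoly_le`: the Hessian of the generic determinant `DET_m` at a
  *singular* matrix `Y` has rank `≤ 2 m` (Mignon–Ressayre 2004; Cai–Chen–Li 2010, §2.1;
  arXiv:2202.13016, Lemma 3.1);
* `rank_hessianMatrix_le_two_mul_of_isAffineDetRepr` and
  `rank_hessianMatrix_le_two_mul_determinantalComplexity`: if `f = det A` for an `m × m` matrix
  `A` of affine linear forms and `f(x) = 0`, then `rank Hess f (x) ≤ 2 m`; hence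
  `rank Hess f (x) ≤ 2 · dc f` at every zero `x` of `f` (arXiv:2202.13016, Prop. 3.2 and Cor. 3.3;
  Mignon–Ressayre 2004).

## Proof of the rank bound (design note)

The printed proofs bring `Y` to the normal form `diag(0, 1, …, 1)` and read off the non-zero second
partials of `det` (signed `(m-2)`-minors). We avoid minors altogether: if `w ≠ 0` is a left null
vector of `Y` (`w ᵥ* Y = 0`, which exists as `det Y = 0`) and `Z¹, Z²` are matrices with
`w ᵥ* Zⁱ = 0`, then `det (Y + a Z¹ + b Z²) = 0` identically in `k[a, b]` (the matrix has the left
null vector `w`), so by the affine chain rule its Hessian `Lᵀ · Hess det (Y) · L` vanishes, whose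
`(a, b)` entry is `Z¹ᵀ · Hess det (Y) · Z²`. Thus the bilinear form `H = Hess det (Y)` vanishes on
`U × U` for the subspace `U = {Z | w ᵥ* Z = 0}`; with the rank-`≤ m` idempotent-like matrix
`Π Z = e_{i₀} ⊗ (w ᵥ* Z) / w i₀` (so that `Z - Π Z ∈ U`) one gets `H = (1 - Π)ᵀ H Π + Πᵀ H`,
hence `rank H ≤ rank Π + rank Π ≤ 2 m`.

## What is not here

The explicit zero of the permanent with non-degenerate Hessian (Mignon–Ressayre 2004, §4;
Landsberg 2017, §6.4.6) lives in `MignonRessayreHessian.lean`; the bound `dc(per_n) ≥ n² / 2`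
is assembled in `PermanentVsDeterminantProofs.lean`.
-/

noncomputable section

open MvPolynomial Matrix

namespace Literature.Computability.AlgebraicComplexity

universe u v w

section Hessian

variable {k : Type u} [CommRing k] {σ : Type v} {τ : Type w}

/-- The *Hessian matrix* of a polynomial `f` at a point `x`: the `σ × σ` matrix of evaluated
second partial derivatives `(∂ᵤ ∂ᵥ f)(x)` (Mignon–Ressayre 2004, §2; Landsberg 2017, §6.4.5,
"`P_{d-2,2}(x^{d-2})` … is called the Hessian"). [cite: MignonRessayre2004, §2] -/
def hessianMatrix (f : MvPolynomial σ k) (x : σ → k) : Matrix σ σ k :=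
  Matrix.of fun u v => eval x (pderiv u (pderiv v f))

/-- Entries of the Hessian matrix (Mignon–Ressayre 2004, §2). [cite: MignonRessayre2004, §2] -/
@[simp]
theorem hessianMatrix_apply (f : MvPolynomial σ k) (x : σ → k) (u v : σ) :
    hessianMatrix f x u v = eval x (pderiv u (pderiv v f)) :=
  rfl

/-- Partial derivatives commute, so the Hessian matrix is symmetric (Schwarz; for polynomials
this is the identity `∂ᵤ ∂ᵥ = ∂ᵥ ∂ᵤ` on monomials). [folklore] -/
theorem pderiv_pderiv_comm (u v : σ) (f : MvPolynomial σ k) :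
    pderiv u (pderiv v f) = pderiv v (pderiv u f) := by
  classical
  ext m
  simp only [coeff_pderiv]
  rw [add_right_comm m (Finsupp.single u 1) (Finsupp.single v 1)]
  simp only [Finsupp.coe_add, Pi.add_apply, Finsupp.single_apply]
  by_cases h : u = v
  · subst h; ring
  · simp [h, Ne.symm h]; ring

/-- The Hessian matrix is symmetric. [folklore] -/
theorem hessianMatrix_transpose (f : MvPolynomial σ k) (x : σ → k) :
    (hessianMatrix f x)ᵀ = hessianMatrix f x := by
  ext u v
  simp [hessianMatrix, pderiv_pderiv_comm u v]

/-- The Hessian of the zero polynomial vanishes. [folklore] -/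
@[simp]
theorem hessianMatrix_zero (x : σ → k) : hessianMatrix (0 : MvPolynomial σ k) x = 0 := by
  ext u v; simp [hessianMatrix]

/-- The Hessian is additive in the polynomial. [folklore] -/
theorem hessianMatrix_add (f g : MvPolynomial σ k) (x : σ → k) :
    hessianMatrix (f + g) x = hessianMatrix f x + hessianMatrix g x := by
  ext u v; simp [hessianMatrix]

/-- The Hessian is `k`-linear in the polynomial: `Hess (c • f) = c • Hess f`. [folklore] -/
theorem hessianMatrix_smul (c : k) (f : MvPolynomial σ k) (x : σ → k) :
    hessianMatrix (c • f) x = c • hessianMatrix f x := by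
  ext u v; simp [hessianMatrix, smul_eval]

/-- Evaluating a substituted polynomial: `(g ∘ φ)(x) = g(φ(x))` (`MvPolynomial.eval₂Hom_bind₁`).
[folklore] -/
theorem eval_aeval_eq_eval (φ : τ → MvPolynomial σ k) (x : σ → k) (g : MvPolynomial τ k) :
    eval x (aeval φ g) = eval (fun t => eval x (φ t)) g :=
  eval₂Hom_bind₁ (RingHom.id k) x φ g

/-- **First-order chain rule** for polynomial substitutions: for `φ : τ → k[σ]` and
`g ∈ k[τ]`, `∂ᵥ (g ∘ φ) = ∑ₜ ((∂ₜ g) ∘ φ) · ∂ᵥ φₜ` (both sides are derivations in `g` agreeing on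
the variables). [folklore] -/
theorem pderiv_aeval_eq_sum [Fintype τ] (φ : τ → MvPolynomial σ k) (g : MvPolynomial τ k)
    (v : σ) : pderiv v (aeval φ g) = ∑ t, aeval φ (pderiv t g) * pderiv v (φ t) := by
  classical
  induction g using MvPolynomial.induction_on with
  | C a => simp [MvPolynomial.algebraMap_eq]
  | add p q hp hq => simp only [map_add, hp, hq, add_mul, Finset.sum_add_distrib]
  | mul_X p t hp =>
      have hX : ∀ s : τ, pderiv s (X t : MvPolynomial τ k) = if s = t then 1 else 0 := fun s => by
        rw [pderiv_X]; simp [Pi.single_apply, eq_comm]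
      simp only [map_mul, aeval_X, pderiv_mul, hp, hX, map_add, Finset.sum_add_distrib,
        add_mul]
      congr 1
      · rw [Finset.sum_mul]
        refine Finset.sum_congr rfl fun s _ => ?_
        ring
      · simp [apply_ite, Finset.sum_ite_eq', mul_comm]

/-- A polynomial of total degree `≤ 1` (an affine linear form) has vanishing second partial
derivatives. [folklore] -/
theorem pderiv_pderiv_eq_zero_of_totalDegree_le_one {f : MvPolynomial σ k}
    (hf : f.totalDegree ≤ 1) (u v : σ) : pderiv u (pderiv v f) = 0 := by
  classical
  ext m
  rw [coeff_pderiv, coeff_pderiv, coeff_zero, coeff_eq_zero_of_totalDegree_lt, zero_mul, zero_mul]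
  change f.totalDegree < Finsupp.degree (m + Finsupp.single u 1 + Finsupp.single v 1)
  rw [map_add, map_add, Finsupp.degree_single, Finsupp.degree_single]
  omega

/-- **Second-order chain rule for affine substitutions.** If every `φₜ` is affine
(`∂ᵤ ∂ᵥ φₜ = 0`), then the Hessian of `g ∘ φ` at `x` is `Lᵀ · Hess g (φ(x)) · L`, where
`L t v = (∂ᵥ φₜ)(x)` is the (constant) Jacobian of `φ` (Mignon–Ressayre 2004, §3;
Cai–Chen–Li 2010, §2.1, "`H(X₀) = L · H_det(Y₀) · Lᵀ`"; arXiv:2202.13016, proof of Prop. 3.2).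
[cite: MignonRessayre2004, §3] -/
theorem hessianMatrix_aeval_of_affine [Fintype τ] (φ : τ → MvPolynomial σ k)
    (hφ : ∀ t u v, pderiv u (pderiv v (φ t)) = 0) (g : MvPolynomial τ k) (x : σ → k) :
    hessianMatrix (aeval φ g) x =
      (Matrix.of fun t v => eval x (pderiv v (φ t)))ᵀ *
        hessianMatrix g (fun t => eval x (φ t)) * Matrix.of fun t v => eval x (pderiv v (φ t)) := by
  classical
  ext u v
  simp only [hessianMatrix, Matrix.mul_apply, Matrix.transpose_apply, Matrix.of_apply,
    Finset.sum_mul]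
  rw [pderiv_aeval_eq_sum, map_sum, map_sum]
  refine Finset.sum_congr rfl fun t _ => ?_
  rw [pderiv_mul, hφ, mul_zero, add_zero, pderiv_aeval_eq_sum, Finset.sum_mul, map_sum]
  refine Finset.sum_congr rfl fun s _ => ?_
  rw [map_mul, map_mul, eval_aeval_eq_eval]
  ring

/-- The affine chain rule for a substitution given by constants plus a linear part:
`φₜ = C cₜ + ∑ᵥ C (L t v) · Xᵥ`. Then `Hess (g ∘ φ)(x) = Lᵀ · Hess g (c + L x) · L`
(Mignon–Ressayre 2004, §3). [cite: MignonRessayre2004, §3] -/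
theorem hessianMatrix_aeval_C_add_linear [Fintype τ] [Fintype σ] (c : τ → k) (L : Matrix τ σ k)
    (g : MvPolynomial τ k) (x : σ → k) :
    hessianMatrix (aeval (fun t => C (c t) + ∑ v, C (L t v) * X v) g) x =
      Lᵀ * hessianMatrix g (fun t => c t + ∑ v, L t v * x v) * L := by
  classical
  have h1 : ∀ t v, pderiv v (C (c t) + ∑ v, C (L t v) * X v : MvPolynomial σ k) = C (L t v) := by
    intro t v
    simp only [map_add, pderiv_C, zero_add, map_sum, pderiv_C_mul]
    rw [Finset.sum_eq_single v]
    · simp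
    · intro b _ hb; simp [pderiv_X_of_ne hb]
    · simp
  have h2 : ∀ t u v, pderiv u (pderiv v (C (c t) + ∑ v, C (L t v) * X v : MvPolynomial σ k)) = 0 :=
    fun t u v => by rw [h1, pderiv_C]
  rw [hessianMatrix_aeval_of_affine _ h2]
  have hL : (Matrix.of fun t v => eval x (pderiv v (C (c t) + ∑ v, C (L t v) * X v))) = L := by
    ext t v; simp [h1]
  have hc : (fun t => eval x (C (c t) + ∑ v, C (L t v) * X v)) = fun t => c t + ∑ v, L t v * x v := by
    ext t; simp [map_sum]
  rw [hL, hc]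

end Hessian

/-! ### The rank of the Hessian of the determinant at a singular matrix -/

section RankBound

variable {k : Type u} [Field k]

/-- Sub-additivity of the rank of matrices over a field: `rank (A + B) ≤ rank A + rank B`.
[folklore] -/
theorem rank_add_le {m n : Type*} [Fintype m] [Fintype n] (A B : Matrix m n k) :
    (A + B).rank ≤ A.rank + B.rank := by
  unfold Matrix.rank
  rw [Matrix.mulVecLin_add]
  exact (Submodule.finrank_mono (LinearMap.range_add_le _ _)).trans
    (Submodule.finrank_add_le_finrank_add_finrank _ _)

variable {ι : Type*} [Fintype ι] [DecidableEq ι]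

/-- **Linear algebra of the Mignon–Ressayre rank bound.** Let `H` be a square matrix indexed by
`ι × ι` (a bilinear form on `ι × ι` matrices `Z`, flattened) and `w ≠ 0` a vector such that
`Z₁ᵀ H Z₂ = 0` whenever `w ᵥ* Z₁ = 0` and `w ᵥ* Z₂ = 0`. Then `rank H ≤ 2 · |ι|`: with the
rank-`≤ |ι|` matrix `Π Z = e_{i₀} ⊗ (w ᵥ* Z) / w_{i₀}` one has `w ᵥ* (Z - Π Z) = 0`, hence
`H = (1 - Π)ᵀ H Π + Πᵀ H` and `rank H ≤ 2 rank Π` (our replacement for the normal-form step of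
Mignon–Ressayre 2004, §3 / Cai–Chen–Li 2010, §2.1). [cite: MignonRessayre2004, §3] -/
theorem rank_le_two_mul_card_of_dotProduct_mulVec_eq_zero (H : Matrix (ι × ι) (ι × ι) k)
    (w : ι → k) (hw : w ≠ 0)
    (hH : ∀ Z₁ Z₂ : ι × ι → k, w ᵥ* (Matrix.of fun i j => Z₁ (i, j)) = 0 →
      w ᵥ* (Matrix.of fun i j => Z₂ (i, j)) = 0 → Z₁ ⬝ᵥ H *ᵥ Z₂ = 0) :
    H.rank ≤ 2 * Fintype.card ι := by
  obtain ⟨i₀, hi₀⟩ : ∃ i, w i ≠ 0 := Function.ne_iff.mp hw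
  set P : Matrix ι (ι × ι) k := Matrix.of fun j q => if q.2 = j then w q.1 else 0 with hP
  set S : Matrix (ι × ι) ι k :=
    Matrix.of fun p j => if p.1 = i₀ ∧ p.2 = j then (w i₀)⁻¹ else 0 with hS
  set Q : Matrix (ι × ι) (ι × ι) k := S * P with hQ
  -- `P` flattens `Z ↦ w ᵥ* Z`.
  have hPZ : ∀ Z : ι × ι → k, P *ᵥ Z = w ᵥ* (Matrix.of fun i j => Z (i, j)) := by
    intro Z
    ext j
    simp only [hP, mulVec, dotProduct, of_apply, vecMul, ite_mul, zero_mul]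
    rw [Fintype.sum_prod_type]
    simp only [Finset.sum_ite_eq', Finset.mem_univ, if_true]
  -- `Q Z` puts `(w ᵥ* Z) / w i₀` into row `i₀`.
  have hQZ : ∀ Z : ι × ι → k, Q *ᵥ Z =
      fun p => if p.1 = i₀ then (w i₀)⁻¹ * (w ᵥ* (Matrix.of fun i j => Z (i, j))) p.2 else 0 := by
    intro Z
    rw [hQ, ← mulVec_mulVec, hPZ]
    ext p
    simp only [hS, mulVec, dotProduct, of_apply, ite_mul, zero_mul]
    by_cases hp : p.1 = i₀
    · simp [hp]
    · simp [hp]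
  -- the key property: `Z - Q Z` is annihilated by `w`.
  have hU : ∀ Z : ι × ι → k, w ᵥ* (Matrix.of fun i j => (Z - Q *ᵥ Z) (i, j)) = 0 := by
    intro Z
    ext j
    rw [hQZ]
    simp only [vecMul, dotProduct, of_apply, Pi.sub_apply, Pi.zero_apply, mul_sub,
      Finset.sum_sub_distrib, mul_ite, mul_zero, Finset.sum_ite_eq', Finset.mem_univ, if_true]
    rw [← mul_assoc, mul_inv_cancel₀ hi₀, one_mul]
    simp
  have hQr : Q.rank ≤ Fintype.card ι := (rank_mul_le_right S P).trans (rank_le_card_height P)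
  clear_value Q
  -- the bilinear identity `H = (1 - Q)ᵀ H Q + Qᵀ H`
  have key' : ∀ Z₁ Z₂ : ι × ι → k,
      Z₁ ⬝ᵥ H *ᵥ Z₂ = Z₁ ⬝ᵥ ((1 - Q)ᵀ * H * Q + Qᵀ * H) *ᵥ Z₂ := by
    intro Z₁ Z₂
    have h0 := hH (Z₁ - Q *ᵥ Z₁) (Z₂ - Q *ᵥ Z₂) (hU Z₁) (hU Z₂)
    have e1 : Z₁ ⬝ᵥ ((1 - Q)ᵀ * H * Q) *ᵥ Z₂ = (Z₁ - Q *ᵥ Z₁) ⬝ᵥ H *ᵥ (Q *ᵥ Z₂) := by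
      rw [← mulVec_mulVec, ← mulVec_mulVec, dotProduct_mulVec, vecMul_transpose, sub_mulVec,
        one_mulVec]
    have e2 : Z₁ ⬝ᵥ (Qᵀ * H) *ᵥ Z₂ = (Q *ᵥ Z₁) ⬝ᵥ H *ᵥ Z₂ := by
      rw [← mulVec_mulVec, dotProduct_mulVec, vecMul_transpose]
    rw [add_mulVec, dotProduct_add, e1, e2, sub_dotProduct]
    rw [mulVec_sub, sub_dotProduct, dotProduct_sub, dotProduct_sub] at h0
    linear_combination h0
  have key : H = (1 - Q)ᵀ * H * Q + Qᵀ * H := by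
    ext p q
    have := key' (Pi.single p 1) (Pi.single q 1)
    rwa [single_one_dotProduct, single_one_dotProduct, mulVec_single_one, mulVec_single_one,
      col_apply, col_apply] at this
  calc H.rank = ((1 - Q)ᵀ * H * Q + Qᵀ * H).rank := by rw [← key]
    _ ≤ ((1 - Q)ᵀ * H * Q).rank + (Qᵀ * H).rank := rank_add_le _ _
    _ ≤ Q.rank + Qᵀ.rank := add_le_add (rank_mul_le_right _ _) (rank_mul_le_left _ _)
    _ = Q.rank + Q.rank := by rw [rank_transpose]
    _ ≤ Fintype.card ι + Fintype.card ι := add_le_add hQr hQr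
    _ = 2 * Fintype.card ι := (two_mul _).symm

/-- **The Hessian of `det` pairs two matrices with a common left null vector of `Y` to zero.**
If `w ≠ 0`, `w ᵥ* Y = 0` and `w ᵥ* Z₁ = w ᵥ* Z₂ = 0`, then `Z₁ᵀ · Hess DET (Y) · Z₂ = 0`:
indeed `det (Y + a Z₁ + b Z₂) = 0` in `k[a, b]` (left null vector `w`), and the `(a, b)` entry of
its Hessian at `0`, computed by the affine chain rule, is this pairing (cf. Mignon–Ressayre 2004,
§3, and Landsberg 2017, §6.4.5, for the normal-form version). [cite: MignonRessayre2004, §3] -/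
theorem dotProduct_hessianMatrix_detPoly_mulVec_eq_zero (Y Z₁ Z₂ : Matrix ι ι k) (w : ι → k)
    (hw : w ≠ 0) (hY : w ᵥ* Y = 0) (h₁ : w ᵥ* Z₁ = 0) (h₂ : w ᵥ* Z₂ = 0) :
    (fun p : ι × ι => Z₁ p.1 p.2) ⬝ᵥ
      hessianMatrix (detPoly ι k) (fun p => Y p.1 p.2) *ᵥ (fun p : ι × ι => Z₂ p.1 p.2) = 0 := by
  set L : Matrix (ι × ι) (Fin 2) k := Matrix.of fun p v => ![Z₁ p.1 p.2, Z₂ p.1 p.2] v with hL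
  set c : ι × ι → k := fun p => Y p.1 p.2 with hc
  let φ : ι × ι → MvPolynomial (Fin 2) k := fun t => C (c t) + ∑ v : Fin 2, C (L t v) * X v
  -- the substituted determinant vanishes identically
  have hdet : aeval φ (detPoly ι k) = 0 := by
    have hΦ : aeval φ (detPoly ι k) = (Matrix.of fun i j => φ (i, j)).det := by
      rw [detPoly, AlgHom.map_det]
      have e := mvPolynomialX_mapMatrix_aeval k (Matrix.of fun i j => φ (i, j))
      simp only [of_apply] at e
      rw [e]
    rw [hΦ]
    refine Matrix.exists_vecMul_eq_zero_iff.mp ⟨fun i => C (w i), ?_, ?_⟩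
    · intro h
      apply hw
      funext i
      have hi := congr_fun h i
      simpa using hi
    · ext j
      have hYj : ∑ i, w i * Y i j = 0 := by simpa [vecMul, dotProduct] using congr_fun hY j
      have h₁j : ∑ i, w i * Z₁ i j = 0 := by simpa [vecMul, dotProduct] using congr_fun h₁ j
      have h₂j : ∑ i, w i * Z₂ i j = 0 := by simpa [vecMul, dotProduct] using congr_fun h₂ j
      have hi : ∀ i, C (w i) * φ (i, j) =
          C (w i * Y i j) + C (w i * Z₁ i j) * X 0 + C (w i * Z₂ i j) * X 1 := by
        intro i
        simp only [φ, hc, hL, of_apply, Fin.sum_univ_two, Matrix.cons_val_zero,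
          Matrix.cons_val_one, map_mul]
        ring
      simp only [vecMul, dotProduct, of_apply, hi, Finset.sum_add_distrib, ← Finset.sum_mul,
        ← map_sum, hYj, h₁j, h₂j, map_zero, zero_mul, add_zero, Pi.zero_apply]
  have hH := hessianMatrix_aeval_C_add_linear c L (detPoly ι k) (0 : Fin 2 → k)
  rw [hdet, hessianMatrix_zero] at hH
  have hpt : (fun t => c t + ∑ v : Fin 2, L t v * (0 : Fin 2 → k) v) = c := by
    ext t; simp
  rw [hpt] at hH
  have h01 := congr_fun (congr_fun hH 0) 1
  rw [Matrix.zero_apply, Matrix.mul_apply] at h01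
  rw [dotProduct_mulVec]
  simp only [Matrix.mul_apply, transpose_apply, vecMul, dotProduct] at h01 ⊢
  rw [h01]
  refine Finset.sum_congr rfl fun q _ => ?_
  simp [hL, hc]

/-- **Rank of the Hessian of the determinant at a singular point** (Mignon–Ressayre 2004, §3;
Cai–Chen–Li 2010, §2.1; arXiv:2202.13016, Lemma 3.1): for any singular `Y ∈ Mat_ι(k)`,
`rank Hess DET_ι (Y) ≤ 2 |ι|`. (Equality `2|ι|` holds for `rank Y = |ι| - 1`, not needed here.)
[cite: MignonRessayre2004, §3] -/
theorem rank_hessianMatrix_detPoly_le (Y : Matrix ι ι k) (hY : Y.det = 0) :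
    (hessianMatrix (detPoly ι k) fun p => Y p.1 p.2).rank ≤ 2 * Fintype.card ι := by
  obtain ⟨w, hw, hwY⟩ := Matrix.exists_vecMul_eq_zero_iff.mpr hY
  refine rank_le_two_mul_card_of_dotProduct_mulVec_eq_zero _ w hw fun Z₁ Z₂ h₁ h₂ => ?_
  exact dotProduct_hessianMatrix_detPoly_mulVec_eq_zero Y (Matrix.of fun i j => Z₁ (i, j))
    (Matrix.of fun i j => Z₂ (i, j)) w hw hwY h₁ h₂

/-- **Mignon–Ressayre, second step** (Mignon–Ressayre 2004, §3; arXiv:2202.13016, Prop. 3.2):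
if `A` is an affine determinantal representation of `f` of size `|m|` and `f(x) = 0`, then
`rank Hess f (x) ≤ 2 |m|`. Proof: `f = DET_m ∘ A`, so `Hess f (x) = Lᵀ · Hess DET (A(x)) · L` by
the affine chain rule, and `A(x)` is singular since `det A(x) = f(x) = 0`.
[cite: MignonRessayre2004, §3] -/
theorem rank_hessianMatrix_le_two_mul_of_isAffineDetRepr {σ : Type*} [Fintype σ]
    {f : MvPolynomial σ k}
    {m : Type*} [Fintype m] [DecidableEq m] {A : Matrix m m (MvPolynomial σ k)}
    (hA : IsAffineDetRepr f A) (x : σ → k) (hx : eval x f = 0) :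
    (hessianMatrix f x).rank ≤ 2 * Fintype.card m := by
  obtain ⟨hdeg, hdet⟩ := hA
  have hf : f = aeval (fun p : m × m => A p.1 p.2) (detPoly m k) := by
    rw [detPoly, AlgHom.map_det, mvPolynomialX_mapMatrix_aeval k A, hdet]
  have hφ : ∀ (t : m × m) (u v : σ), pderiv u (pderiv v (A t.1 t.2)) = 0 := fun t u v =>
    pderiv_pderiv_eq_zero_of_totalDegree_le_one (hdeg t.1 t.2) u v
  rw [hf, hessianMatrix_aeval_of_affine _ hφ]
  set Y : Matrix m m k := Matrix.of fun i j => eval x (A i j) with hYdef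
  have hYdet : Y.det = 0 := by
    have hmap : (MvPolynomial.eval x).mapMatrix A = Y := by
      ext i j; rfl
    rw [← hmap, ← RingHom.map_det, hdet, hx]
  refine (rank_mul_le_left _ _).trans ((rank_mul_le_right _ _).trans ?_)
  exact rank_hessianMatrix_detPoly_le Y hYdet

/-- **Mignon–Ressayre rank bound** (Mignon–Ressayre 2004, §3; arXiv:2202.13016, Cor. 3.3): at
every zero `x` of a polynomial `f` over a field, `rank Hess f (x) ≤ 2 · dc f`, where
`dc = determinantalComplexity` (the infimum is attained: `hasDetRepr_determinantalComplexity_holds`,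
resting on Valiant universality). [cite: MignonRessayre2004, §3] -/
theorem rank_hessianMatrix_le_two_mul_determinantalComplexity {σ : Type*} [Fintype σ]
    (f : MvPolynomial σ k) (x : σ → k) (hx : eval x f = 0) :
    (hessianMatrix f x).rank ≤ 2 * determinantalComplexity f := by
  obtain ⟨A, hA⟩ := hasDetRepr_determinantalComplexity_holds f
  simpa using rank_hessianMatrix_le_two_mul_of_isAffineDetRepr hA x hx

end RankBound

end Literature.Computability.AlgebraicComplexity
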